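import Literature.MathematicalPhysics.QuantumFieldTheory.Balaban1983to89.B9Ineq385V3Concrete
import Literature.MathematicalPhysics.QuantumFieldTheory.Balaban1983to89.B9Eq373CurvComm

/-!
# `Balaban1983to89.B9Ineq386V3Concrete` — B9 p. 407 «Thus Theorem 3.4 is proved, assuming that Theorems 3.1–3.3 hold» FOR THE CONCRETE
# `V₃(A)` OF (3.82): Theorem 3.4's `G`-clause, entries (3.42)₁ AND (3.42)₃ (`|G(U′U)|` and `|G(U′U)∇*|`) for one and the same `G(U′U)`,
# with EVERY `V₃`-side hypothesis of the device `B9Ineq386CommSum.thm34_G_entries13_opForm_of_comm_sum` (`hV₃`, `hV₃′`, `h371`, `hV0`,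
# `hV1`, `hComm`) DISCHARGED by the G-side twin (files 1–7) — eighth file, the capstone of the twin

statement-level skeleton of published theorems with citation tags; proofs where landed; nothing here is a claim about the Yang–Mills mass gap

CITATION HEADER (lean-in-tree rule).  T. Bałaban, *Propagators for lattice gauge theories in a background field*, Commun. Math. Phys.
**99** (1985) 389–434 [Balaban1985BackgroundPropagators] (cell paper B9; held `paper:balaban1985-cmp99-background-propagators`, journal
page = PDF page + 388), p. 407 [PDF 19] and p. 400 (Theorem 3.4), p. 397 (3.42), p. 398 («In the above inequalities we may always replace
∇_U by ∇*_U»); render `b2b-balaban-ref1/pages/…-p019-x2.png` and OCR page p0019 re-read by this seat (2026-08-21).  THE PRINT (verbatim,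
p. 407): «Let us denote the sum of these three operators by V(A). We can write (3.82) as Δ_a(U′U) = Δ_a(U) − V(A) = (I − V(A)G(U))Δ_a(U).
(3.84) Using the bounds (3.73), (3.77), (3.83) and assuming that Theorem 3.3 holds for G(U), we get |(V(A)G(U)J)(b)| ≦ O(1)α₁
e^{−(1/2)δ₀d(y,y′)}|J| for b ∈ Δ(y), supp J ⊂ Δ(y′). (3.85) […] hence V(A)G(U) is a small operator in supremum norm, and we have G(U′U) =
G(U)(I − V(A)G(U))⁻¹ = Σ_{n=0}^∞ G(U)(V(A)G(U))ⁿ, (3.86) […] The operator V₃(A) is a local differential operator of the first order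
satisfying the bound (3.73). […] Thus Theorem 3.4 is proved, assuming that Theorems 3.1-3.3 hold.»  [4] = [Balaban1984PropagatorsII],
(2.51)–(2.55) p. 232, Lemma 2.1 p. 234, (2.66) p. 234.  [15] = [Balaban1985Variational] (135) p. 298 (the curvature commutator, via file 7).
Cell `lit-balaban`, seat r06 (B9 fold owner) gen 11; SKELETON rows **B9.Thm3.4** × **B9.Eq3.85** × B9.Eq3.82 × B9.Eq3.42.

SIBLINGS REUSED BY NAME (imported; nothing restated): the device `B9Ineq386CommSum.thm34_G_entries13_opForm_of_comm_sum` (gen 8; (3.84)–(3.86)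
with the finite-sum gradient form and one commutator per letter ⇒ (3.42)₁ and (3.42)₃); `B9Ineq385V3Concrete.cV385`/`cV0_nonneg`/
`cV385_nonneg` (file 5); the G-side twin's `conj_V₃Op_eq_gradForm` (`hV₃`), `conj_V₃Op_eq_vThree` (`hV₃′`), `conj_lapDDLetter_prodCfg` (`h371`),
`hasMajorant_V₃_zero` (`hV0`), `hasMajorant_V₃_one` (`hV1`), `B9Eq373CurvComm.hasMajorant_comm_V₃_one` (`hComm`, file 7 + file 6);
`B12Eq313JSlot.norm_plaqU_swap_sub_one_le` (orientation change of the plaquette hypothesis).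

WHAT THIS FILE PROVES (0 sorry; theorems only; no definitions, no `def … : Prop`).
* `norm_plaqU_adjacent_of_through` — the (3.35) bookkeeping: the Through-form plaquette hypothesis of files 4–5 (positively oriented
  plaquettes `p_{mn}(y)`, `m < n`, through each bond, measured at the bond's block) implies file 7's «adjacent plaquette» form
  `‖U(∂p_{mn}(x − e_n)) − 1‖ ≦ C₀L^{−2j(y(x))}` for ALL ordered pairs, for a group-valued background (orientation swap costs `ρ⁴ = 1`;
  `m = n` is trivial).
* **`thm34_G_entries13_concreteV₃`** — THEOREM 3.4, `G`-CLAUSE, ENTRIES (3.42)₁ AND (3.42)₃, FOR THE CONCRETE PERTURBATION OF (3.82): with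
  `Δ_a(U) = deltaA DsD Δp DRDs Qs a Q`, `DsD := conj b (lapDDLetter η⁻¹ U)`, `Δp := conj b (Δ′(U))`, the CONCRETE `DsD′ := conj b (lapDDLetter
  η⁻¹ (U′U))`, `Δp′ := conj b (Δ′(U′U))`, the abstract (3.76)/(3.80) data (`DRDs′ = DRDs − conj b V₂Op − P₁`, `Q′ = Q + F₂`, `Q*′ = Q* + F₂*`,
  `P₂ = pTwo …`), `G = G(U)` a two-sided inverse of `Δ_a(U)` with Theorem 3.3's (3.42)₁ and the product entries `∇_kG`, `G∇_k`, `G∇*`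
  (`k ∈ κ ⊕ κ`; `∇*` = an arbitrary letter `Ds` with `G·Ds ≺ B₀Lʲη e^{−δd}`), commuting shifts, a group-valued background with (3.35) on
  the plaquettes through each bond, (3.37) for `A` blockwise in the shapes files 1–7 read it, `η = g.eta > 0`, `L ≧ 1`, `η·α₁(Lʲη)⁻¹ ≦
  1/4`, the stencil geometry, the located rate bookkeeping of the devices, and ONE smallness condition `κ₃₈₅′α₁c₁(α′) < 1` with `κ₃₈₅′ =
  kappa385 B₀ (c_V + Σ_{k∈κ⊕κ} c_K) κ₁ κ₂ Λ c₁`, `c_V = cV385`, `c_K = (10 + 8d + (16d + 12)C₀)·M` («α₁ sufficiently small»): THERE IS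
  `G(U′U)`, a two-sided inverse of `Δ_a(U′U) = deltaA DsD′ Δp′ DRDs′ Qs′ a Q′`, with `G(U′U) ≺ B₀c₁(α′)(1 − κ₃₈₅′α₁c₁(α′))⁻¹(Lʲη)²
  e^{−(1−α′)ρd}` ((3.42)₁) AND `G(U′U)·∇* ≺ B₀Λ_ρ²c₁(α′)(1 − κ₃₈₅′α₁c₁(α′))⁻¹Lʲη e^{−(1−3α′)ρd}` ((3.42)₃).

HONEST SCOPE / NOT CLAIMED.  (i) `P₁(A)` ((3.76)–(3.77)), `P₂(A)` ((3.80)–(3.83)), the `DRD*`/averaging expansions `h376`/`h380`, the inverse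
property of `G(U)` ((3.27)) and Theorem 3.3's entries for `G(U)` (incl. the product entries `∇_kG`, `G∇_k`, `G∇*`) remain HYPOTHESES (other
rows/lanes); entries (3.42)₂ (`|∇G(U′U)|`) and (3.42)₄ (Hölder) and the (3.43)–(3.47) norms are not here.  (ii) Group-valued background
(`‖U^{±1}‖ ≦ 1`), commuting shifts, `η = g.eta`, (3.35) as `‖U(∂p) − 1‖ ≦ C₀L^{−2j}` on the plaquettes through each bond at that bond's block
scale, (3.37) blockwise in twelve shapes, stencil block distances — hypotheses, as in files 4–7.  (iii) Real coordinates `(κ × S) × ι`, finite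
lattice (`[Fintype S]`, Neumann series), block map `((μ,x),i) ↦ y(x)`; rate bookkeeping as in the devices (`ρ + (α+β)δ₀ ≦ δ`; the output rate
of (3.42)₃ is `(1 − 3α′)ρ`, the device's located Lemma-2.1 loss, NOT the print's `δ₀`).  (iv) The constant `Σ_{k∈κ⊕κ} c_K` is left as the
printed finite sum over the `2d` letters (= `2d·c_K`).  Value = Theorem 3.4's `G`-clause, entries 1 and 3, closed on the `V₃` side for the
concrete perturbation; NOT summit progress.

RELATED IN THE TREE, NOT DUPLICATED (searched 2026-08-21: `lean search 'B9Ineq386V3Concrete|thm34_G_entries13_concrete|plaqU_adjacent_of_through'`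
= ∅): `B9Ineq385V3Concrete.thm34_G_entry1_concreteV₃` (file 5) is entry (3.42)₁ alone under fewer hypotheses (no commutators) — kept, not
superseded; `B9Ineq386CommSum.thm34_G_entries13_opForm_of_comm_sum` is the ABSTRACT device; gen 9's `B9Ineq363Vprime.thm34_Gp_entries13_vPrime`
is the G′-side analogue for the concrete `V′(A)`.
-/

noncomputable section

namespace Literature.MathematicalPhysics.QuantumFieldTheory.Balaban1983to89.B9Ineq386V3Concrete

open NormedSpace Complex
open Literature.MathematicalPhysics.QuantumFieldTheory.Balaban1983to89
open Literature.MathematicalPhysics.QuantumFieldTheory.Balaban1983to89.B6RandomWalk (HasMajorant hasMajorant_mono hasMajorant_add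
  Triangle254 Ineq261)
open Literature.MathematicalPhysics.QuantumFieldTheory.Balaban1983to89.B9Thm34Ext (toB6)
open Literature.MathematicalPhysics.QuantumFieldTheory.Balaban1983to89.B9Ineq347 (ScaleTransfer)
open Literature.MathematicalPhysics.QuantumFieldTheory.Balaban1983to89.B9Eq386Neumann (vTotal vThree pTwo deltaA)
open Literature.MathematicalPhysics.QuantumFieldTheory.Balaban1983to89.B9Ineq385VG (kappa385 kappa385_nonneg)
open Literature.MathematicalPhysics.QuantumFieldTheory.Balaban1983to89.B9Ineq386CommSum (thm34_G_entries13_opForm_of_comm_sum)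
open Literature.MathematicalPhysics.QuantumFieldTheory.Balaban1983to89.B9Eq39Adjoint
open Literature.MathematicalPhysics.QuantumFieldTheory.Balaban1983to89.B9Eq369Small (Through)
open Literature.MathematicalPhysics.QuantumFieldTheory.Balaban1983to89.B9Eq372Locality (stBonds)
open Literature.MathematicalPhysics.QuantumFieldTheory.Balaban1983to89.B9Eq352DivForm (tauF tauB)
open Literature.MathematicalPhysics.QuantumFieldTheory.Balaban1983to89.B9Eq352DivFormLetters
open Literature.MathematicalPhysics.QuantumFieldTheory.Balaban1983to89.B9Eq352GradLetters (diffLetter)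
open Literature.MathematicalPhysics.QuantumFieldTheory.Balaban1983to89.B9Eq371GradLetters (bT bU zeroLetter V1Letter)
open Literature.MathematicalPhysics.QuantumFieldTheory.Balaban1983to89.B9Eq375GradLetters (zeroLetter₂ V1Letter₂)
open Literature.MathematicalPhysics.QuantumFieldTheory.Balaban1983to89.B9Eq372RemLetters
open Literature.MathematicalPhysics.QuantumFieldTheory.Balaban1983to89.B9Eq382V3Letters
open Literature.MathematicalPhysics.QuantumFieldTheory.Balaban1983to89.B9Ineq385V3Concrete (cV385 cV0_nonneg cV385_nonneg)
open Literature.MathematicalPhysics.QuantumFieldTheory.Balaban1983to89.B12Eq313JSlot (norm_plaqU_swap_sub_one_le)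
open Literature.MathematicalPhysics.QuantumFieldTheory.Balaban1983to89.B9Eq373CurvComm (hasMajorant_comm_V₃_one)

/-! ## §1  (3.35): the plaquettes through a bond control the plaquettes adjacent to a site, both orientations -/

section Plaquettes

variable {𝔸 : Type*} [NormedRing 𝔸] {S : Type} {κ : Type} [LinearOrder κ]
variable (T : κ → Equiv.Perm S) (U : κ → S → 𝔸ˣ) {g : B9.Geometry}

/-- **(3.35), THROUGH-FORM ⇒ ADJACENT-FORM** (group-valued background): if `‖U(∂p_{mn}(y)) − 1‖ ≦ C₀L^{−2j(y(x))}` for every positively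
oriented plaquette `p_{mn}(y)` (`m < n`) through a bond at `x` (`B9Eq369Small.Through`), then `‖U(∂p_{mn}(x − e_n)) − 1‖ ≦ C₀L^{−2j(y(x))}` for ALL
ordered pairs `(m, n)` — the plaquette `p_{mn}(x − e_n)` contains the bond `(m, x)`; the reversed orientation is the inverse plaquette
variable (`B12Eq313JSlot.norm_plaqU_swap_sub_one_le`, factor `ρ⁴ = 1`); `m = n` gives `U(∂p) = 1`.
[cite: Balaban1985BackgroundPropagators, (3.35) p.396 + (3.1) p.390 + (3.5) p.391 + p.404 after (3.69)] -/
theorem norm_plaqU_adjacent_of_through (blk : S → g.Site) {C₀ : ℝ} (hC₀ : 0 ≤ C₀)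
    (hU1 : ∀ m z, ‖((U m z : 𝔸ˣ) : 𝔸)‖ ≤ 1 ∧ ‖(((U m z)⁻¹ : 𝔸ˣ) : 𝔸)‖ ≤ 1)
    (h35 : ∀ μ x m n y, Through T μ x m n y → ‖(plaqU T U m n y : 𝔸) - 1‖ ≤ C₀ * ((g.L ^ g.scale (blk x))⁻¹) ^ 2)
    (m n : κ) (x : S) :
    ‖(plaqU T U m n ((T n).symm x) : 𝔸) - 1‖ ≤ C₀ * ((g.L ^ g.scale (blk x))⁻¹) ^ 2 := by
  rcases lt_trichotomy m n with hlt | rfl | hgt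
  · exact h35 m x m n ((T n).symm x) ⟨hlt, Or.inr ⟨rfl, Or.inr rfl⟩⟩
  · have h1 : (plaqU T U m m ((T m).symm x) : 𝔸) - 1 = 0 := by
      rw [sub_eq_zero, plaqU]
      simp
    rw [h1, norm_zero]
    positivity
  · have h := h35 m x n m ((T n).symm x) ⟨hgt, Or.inl ⟨rfl, Or.inr rfl⟩⟩
    exact (norm_plaqU_swap_sub_one_le T U hU1 n m ((T n).symm x)).trans (by rw [one_pow, one_mul]; exact h)

end Plaquettes

/-! ## §2  Theorem 3.4, `G`-clause, entries (3.42)₁ and (3.42)₃, for the concrete `V₃(A)` -/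

section Concrete

variable {𝔸 : Type*} [NormedRing 𝔸] [NormedAlgebra ℂ 𝔸] [CompleteSpace 𝔸] {ι : Type} [Fintype ι]
variable (b : Module.Basis ι ℝ 𝔸) {S : Type} {κ : Type} [Fintype κ] [LinearOrder κ]
variable (T : κ → Equiv.Perm S) (U : κ → S → 𝔸ˣ)
variable {g : B9.Geometry} [Fintype g.Site] {Rr : ℝ} {H : Prop}

/-- **THEOREM 3.4, `G`-CLAUSE, ENTRIES (3.42)₁ AND (3.42)₃, FOR THE CONCRETE PERTURBATION OF (3.82)** («Thus Theorem 3.4 is proved, assuming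
that Theorems 3.1–3.3 hold», for `|G(U′U)|` and `|G(U′U)∇*_U|`): the device `B9Ineq386CommSum.thm34_G_entries13_opForm_of_comm_sum` with ALL its
`V₃`-side hypotheses discharged by the G-side twin — `hV₃` := `conj_V₃Op_eq_gradForm` (the `2d` letters `k ∈ κ ⊕ κ`), `hV₃′` :=
`conj_V₃Op_eq_vThree`, `h371` := `conj_lapDDLetter_prodCfg`, `hV0` := `hasMajorant_V₃_zero` (`c_V = cV385`), `hV1` := `hasMajorant_V₃_one` (`c_{1,k} =
14(d+1)M`), `hComm` := `B9Eq373CurvComm.hasMajorant_comm_V₃_one` (`c_{K,k} = (10 + 8d + (16d + 12)C₀)M`; file 7, via CMP 102's Weitzenböck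
commutator).  Remaining inputs: commuting shifts; a group-valued background with (3.35) on the plaquettes through each bond; (3.37) for `A`
blockwise; `η = g.eta > 0`, `L ≧ 1`, `η·α₁(Lʲη)⁻¹ ≦ 1/4`; the stencil geometry; the devices' located geometry/rates ((2.54), (2.61), Lemma
2.1 of [4] as `ScaleTransfer` at the rates `δ₀` and `ρ`, `ρ + (α+β)δ₀ ≦ δ`, `α′ ≦ 1`, `0 ≦ α′ρ`, `0 ≦ (1 − 2α′)ρ`); abstract `P₁`, `P₂` with their
(3.77)/(3.83) majorants; the (3.76)/(3.80) expansions; `Δ_a(U)G(U) = G(U)Δ_a(U) = 1`; Theorem 3.3's (3.42)₁ for `G(U)` and the product entries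
`∇_kG(U)`, `G(U)∇_k` (`k ∈ κ ⊕ κ`) and `G(U)∇*` (`Ds` any letter) of size `B₀Lʲη e^{−δd}`; the smallness `κ₃₈₅′α₁c₁(α′) < 1`.
CONCLUSION: a two-sided inverse `G(U′U)` of `Δ_a(U′U) = deltaA (conj b D*D_{U′U}) (conj b Δ′(U′U)) DRDs′ Qs′ a Q′` with
`G(U′U) ≺ B₀c₁(α′)(1 − κ₃₈₅′α₁c₁(α′))⁻¹(Lʲη)²e^{−(1−α′)ρd}` and `G(U′U)·∇* ≺ B₀Λ_ρ²c₁(α′)(1 − κ₃₈₅′α₁c₁(α′))⁻¹Lʲη·e^{−(1−3α′)ρd}`.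
[cite: Balaban1985BackgroundPropagators, Thm 3.4 p.400 + (3.82)–(3.86) p.407 + (3.70)–(3.73) pp.404–405 + (3.37)/(3.35) p.396 + (3.27) p.395 + (3.42) p.397 + p.398 (remarks); Balaban1984PropagatorsII, (2.66) p.234 + Lemma 2.1 p.234 + (2.51)–(2.55) p.232; Balaban1985Variational, (135) p.298] -/
theorem thm34_G_entries13_concreteV₃ [Fintype S] [DecidableEq S] [DecidableEq ι] (blk : S → g.Site) (d : ℕ)
    (δ₀ δ α β ρ α' Λ Λρ B₀ κ₁ κ₂ α₁ C₀ d₀ M₂ : ℝ)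
    (hB₀ : 0 ≤ B₀) (hκ₁ : 0 ≤ κ₁) (hκ₂ : 0 ≤ κ₂) (hα₁ : 0 ≤ α₁) (hC₀ : 0 ≤ C₀) (hΛ : 0 ≤ Λ) (hΛρ : 0 ≤ Λρ) (hρ : 0 ≤ ρ)
    (hα : 0 ≤ α) (hβ : 0 ≤ β) (hδ₀ : 0 ≤ δ₀) (hδ : 0 ≤ δ) (hM₂ : 0 ≤ M₂) (hr : ρ + (α + β) * δ₀ ≤ δ) (hα' : α' ≤ 1)
    (hα'ρ0 : 0 ≤ α' * ρ) (hα'ρ2 : 0 ≤ (1 - 2 * α') * ρ)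
    (hdnn : ∀ a a' : g.Site, 0 ≤ g.dist a a') (htri : Triangle254 (toB6 g Rr H)) (hrefl : ∀ y : g.Site, g.dist y y = 0)
    (hsym : ∀ y y' : g.Site, g.dist y y' = g.dist y' y) (hlen : ∀ y : g.Site, 0 < g.len y)
    (h261 : Ineq261 d (toB6 g Rr H) δ₀ β) (h261' : Ineq261 d (toB6 g Rr H) ρ α')
    (hT1 : ScaleTransfer g δ₀ α Λ (fun a => g.len a)) (hT2 : ScaleTransfer g δ₀ α Λ (fun a => g.len a ^ 2))
    (hT1i : ScaleTransfer g δ₀ α Λ (fun a => (g.len a)⁻¹)) (hT2i : ScaleTransfer g δ₀ α Λ (fun a => (g.len a ^ 2)⁻¹))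
    (hTρ : ScaleTransfer g ρ α' Λρ (fun a => g.len a))
    (hsmall385 : kappa385 B₀
        (cV385 (Fintype.card κ) α₁ C₀ (M₂ * (∑ i, ‖b i‖) * Real.exp (δ * d₀))
          + ∑ _k ∈ (Finset.univ : Finset (κ ⊕ κ)),
            (10 + 8 * Fintype.card κ + (16 * Fintype.card κ + 12) * C₀) * (M₂ * (∑ i, ‖b i‖) * Real.exp (δ * d₀)))
        κ₁ κ₂ Λ (B6.c1 d δ₀ β) * α₁ * B6.c1 d ρ α' < 1)
    (hrepr : ∀ (v : 𝔸) (i : ι), |b.repr v i| ≤ M₂ * ‖v‖) (hη : 0 < g.eta) (hL : 1 ≤ g.L) (A : κ → S → 𝔸)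
    (hT : ∀ (μ ν : κ) (x : S), T μ (T ν x) = T ν (T μ x))
    (hsmall : ∀ y : g.Site, g.eta * (α₁ * (g.len y)⁻¹) ≤ 1 / 4)
    (hU1 : ∀ m z, ‖((U m z : 𝔸ˣ) : 𝔸)‖ ≤ 1 ∧ ‖(((U m z)⁻¹ : 𝔸ˣ) : 𝔸)‖ ≤ 1)
    -- (3.37) for the exponent field, blockwise, in the shapes files 1–7 read it
    (h337B : ∀ ν k x, ‖((g.eta : ℂ)⁻¹) • covDstar T U ν (A k) x‖ ≤ α₁ * (g.len (blk x) ^ 2)⁻¹)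
    (h337F : ∀ μ ν x, ‖((g.eta : ℂ)⁻¹) • covD T U μ (A ν) x‖ ≤ α₁ * (g.len (blk x) ^ 2)⁻¹)
    (h337B' : ∀ μ ν x, ‖((g.eta : ℂ)⁻¹) • covDstar T U ν (A ν) (T μ x)‖ ≤ α₁ * (g.len (blk x) ^ 2)⁻¹)
    (h337Bτ : ∀ μ x, ‖((g.eta : ℂ)⁻¹) • covDstar T U μ (tauB T U μ (A μ)) x‖ ≤ α₁ * (g.len (blk x) ^ 2)⁻¹)
    (h337FB : ∀ μ ν k x, ‖((g.eta : ℂ)⁻¹) • covD T U μ (A k) ((T ν).symm x)‖ ≤ α₁ * (g.len (blk x) ^ 2)⁻¹)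
    (hA : ∀ k x, ‖A k x‖ ≤ α₁ * (g.len (blk x))⁻¹) (hAτB : ∀ ν k x, ‖tauB T U ν (A k) x‖ ≤ α₁ * (g.len (blk x))⁻¹)
    (hAτF : ∀ μ k x, ‖tauF T U μ (A k) x‖ ≤ α₁ * (g.len (blk x))⁻¹)
    (hAFB : ∀ k μ ν x, ‖A k ((T ν).symm (T μ x))‖ ≤ α₁ * (g.len (blk x))⁻¹)
    (hAst : ∀ μ x m z, (m, z) ∈ stBonds T μ x → ‖A m z‖ ≤ α₁ * (g.len (blk x))⁻¹)
    (hAloc : ∀ μ x m z, (m, z) ∈ B9Eq375Locality.locBondsA T μ x → ‖A m z‖ ≤ α₁ * (g.len (blk x))⁻¹)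
    (hdAst : ∀ μ x m n y, Through T μ x m n y →
      ‖covD T U m (A n) y‖ ≤ g.eta * (α₁ * ((g.len (blk x))⁻¹) ^ 2) ∧
        ‖covD T U n (A m) y‖ ≤ g.eta * (α₁ * ((g.len (blk x))⁻¹) ^ 2))
    -- (3.35) on the plaquettes through each bond, at that bond's block scale
    (h35 : ∀ μ x m n y, Through T μ x m n y → ‖(plaqU T U m n y : 𝔸) - 1‖ ≤ C₀ * ((g.L ^ g.scale (blk x))⁻¹) ^ 2)
    -- stencil geometry
    (hd₀B : ∀ μ x, g.dist (blk x) (blk ((T μ).symm x)) ≤ d₀) (hd₀F : ∀ μ x, g.dist (blk x) (blk (T μ x)) ≤ d₀)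
    (hd₀FB : ∀ μ ν x, g.dist (blk x) (blk ((T ν).symm (T μ x))) ≤ d₀)
    (hd₀st : ∀ μ x (q : κ × S), q ∈ stBonds T μ x → g.dist (blk x) (blk q.2) ≤ d₀)
    (hd₀loc : ∀ μ x (q : κ × S), q ∈ B9Eq375Locality.locBondsA' T μ x → g.dist (blk x) (blk q.2) ≤ d₀)
    (hd₀0 : ∀ y : g.Site, g.dist y y ≤ d₀)
    -- the abstract data of (3.76)/(3.80), the inverse property and Theorem 3.3 for G(U)
    {G Ds P₁ P₂ DRDs DRDs' Qs Qs' Q Q' a F₂ F₂s : Module.End ℝ ((κ × S) × ι → ℝ)}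
    (h376 : DRDs' = DRDs - conj b (V₂Op T U g.eta A) - P₁) (h380 : Q' = Q + F₂) (h380s : Qs' = Qs + F₂s)
    (hP₂def : P₂ = pTwo Qs Q F₂ F₂s a)
    (hΔG : deltaA (conj b (lapDDLetter T ((g.eta : ℂ)⁻¹) U)) (conj b (dPrimeLetter T U g.eta)) DRDs Qs a Q * G = 1)
    (hGΔ : G * deltaA (conj b (lapDDLetter T ((g.eta : ℂ)⁻¹) U)) (conj b (dPrimeLetter T U g.eta)) DRDs Qs a Q = 1)
    (hP₁ : HasMajorant (g := toB6 g Rr H) (fun q : (κ × S) × ι => blk q.1.2) P₁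
      (fun a a' => κ₁ * α₁ * (g.len a ^ 2)⁻¹ * Real.exp (-(δ * g.dist a a'))))
    (hP₂ : HasMajorant (g := toB6 g Rr H) (fun q : (κ × S) × ι => blk q.1.2) P₂
      (fun a a' => κ₂ * α₁ * (g.len a ^ 2)⁻¹ * Real.exp (-(δ * g.dist a a'))))
    (hG : HasMajorant (g := toB6 g Rr H) (fun q : (κ × S) × ι => blk q.1.2) G
      (fun a a' => B₀ * g.len a ^ 2 * Real.exp (-(δ * g.dist a a'))))
    (hDG : ∀ k : κ ⊕ κ, HasMajorant (g := toB6 g Rr H) (fun q : (κ × S) × ι => blk q.1.2)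
      (conj b (diffLetter (bT T) (bU U) ((g.eta : ℂ)⁻¹) k) * G) (fun a a' => B₀ * g.len a * Real.exp (-(δ * g.dist a a'))))
    (hGD : ∀ k : κ ⊕ κ, HasMajorant (g := toB6 g Rr H) (fun q : (κ × S) × ι => blk q.1.2)
      (G * conj b (diffLetter (bT T) (bU U) ((g.eta : ℂ)⁻¹) k)) (fun a a' => B₀ * g.len a * Real.exp (-(δ * g.dist a a'))))
    (hGDs : HasMajorant (g := toB6 g Rr H) (fun q : (κ × S) × ι => blk q.1.2) (G * Ds)
      (fun a a' => B₀ * g.len a * Real.exp (-(δ * g.dist a a')))) :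
    ∃ GExt : Module.End ℝ ((κ × S) × ι → ℝ),
      deltaA (conj b (lapDDLetter T ((g.eta : ℂ)⁻¹) (prodCfg U g.eta A)))
          (conj b (dPrimeLetter T (prodCfg U g.eta A) g.eta)) DRDs' Qs' a Q' * GExt = 1 ∧
      GExt * deltaA (conj b (lapDDLetter T ((g.eta : ℂ)⁻¹) (prodCfg U g.eta A)))
          (conj b (dPrimeLetter T (prodCfg U g.eta A) g.eta)) DRDs' Qs' a Q' = 1 ∧
      HasMajorant (g := toB6 g Rr H) (fun q : (κ × S) × ι => blk q.1.2) GExt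
        (fun a a' => B₀ * B6.c1 d ρ α' *
          (1 - kappa385 B₀
            (cV385 (Fintype.card κ) α₁ C₀ (M₂ * (∑ i, ‖b i‖) * Real.exp (δ * d₀))
              + ∑ _k ∈ (Finset.univ : Finset (κ ⊕ κ)),
                (10 + 8 * Fintype.card κ + (16 * Fintype.card κ + 12) * C₀) * (M₂ * (∑ i, ‖b i‖) * Real.exp (δ * d₀)))
            κ₁ κ₂ Λ (B6.c1 d δ₀ β) * α₁ * B6.c1 d ρ α')⁻¹ *
          g.len a ^ 2 * Real.exp (-((1 - α') * ρ * g.dist a a'))) ∧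
      HasMajorant (g := toB6 g Rr H) (fun q : (κ × S) × ι => blk q.1.2) (GExt * Ds)
        (fun a a' => B₀ * Λρ ^ 2 * B6.c1 d ρ α' *
          (1 - kappa385 B₀
            (cV385 (Fintype.card κ) α₁ C₀ (M₂ * (∑ i, ‖b i‖) * Real.exp (δ * d₀))
              + ∑ _k ∈ (Finset.univ : Finset (κ ⊕ κ)),
                (10 + 8 * Fintype.card κ + (16 * Fintype.card κ + 12) * C₀) * (M₂ * (∑ i, ‖b i‖) * Real.exp (δ * d₀)))
            κ₁ κ₂ Λ (B6.c1 d δ₀ β) * α₁ * B6.c1 d ρ α')⁻¹ *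
          g.len a * Real.exp (-((1 - 3 * α') * ρ * g.dist a a'))) := by
  set M : ℝ := M₂ * (∑ i, ‖b i‖) * Real.exp (δ * d₀) with hM
  have hbsum : 0 ≤ ∑ i, ‖b i‖ := Finset.sum_nonneg fun i _ => norm_nonneg _
  have hM0 : 0 ≤ M := by positivity
  have hcV0 := cV0_nonneg (Fintype.card κ) hα₁ hC₀
  have hcV := cV385_nonneg (Fintype.card κ) hα₁ hC₀ hM0
  have hcK0 : 0 ≤ (10 + 8 * Fintype.card κ + (16 * Fintype.card κ + 12) * C₀) * M := by positivity
  -- (3.35) in file 7's adjacent form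
  have h35adj := norm_plaqU_adjacent_of_through T U blk hC₀ hU1 h35
  -- the discharged `V₃`-side inputs
  have hV₃ := conj_V₃Op_eq_gradForm T U b g.eta A
  have hV₃' := conj_V₃Op_eq_vThree T U b g.eta A
  have h371 := conj_lapDDLetter_prodCfg (b := b) (T := T) (U := U) hη.ne' A
  have hV0 := hasMajorant_V₃_zero (Rr := Rr) (H := H) b T U blk hη hL A C₀ d₀ δ M₂ α₁ hα₁ hC₀ hδ hM₂ hrepr hlen hsmall hU1
    h337B h337F h337B' hAst hAloc hdAst h35 hd₀B hd₀F hd₀FB hd₀st hd₀loc hd₀0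
  have hV1 := hasMajorant_V₃_one (Rr := Rr) (H := H) b T U blk A d₀ δ M₂ α₁ hα₁ hδ hM₂ hrepr hlen hA hAτB hAτF hU1 hd₀B hd₀F hd₀0
  have hComm := hasMajorant_comm_V₃_one (Rr := Rr) (H := H) b T U blk hη hL A C₀ d₀ δ M₂ α₁ hα₁ hC₀ hδ hM₂ hrepr hT hU1 hA hAτB
    hAτF hAFB h337F h337B h337B' h337Bτ h337FB h35adj hd₀B hd₀F hd₀FB
  -- the (3.73) zeroth-order letter at the constant `c_V = cV385`
  have hV0' : HasMajorant (g := toB6 g Rr H) (fun q : (κ × S) × ι => blk q.1.2)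
      (conj b (zeroLetter T U ((g.eta : ℂ)⁻¹) A + F₁Letter T U g.eta A)
        - conj b (dPrimeLetter T (prodCfg U g.eta A) g.eta - dPrimeLetter T U g.eta)
        + conj b (zeroLetter₂ T U ((g.eta : ℂ)⁻¹) A + F₂Letter T U g.eta A))
      (fun a a' => cV385 (Fintype.card κ) α₁ C₀ M * α₁ * (g.len a ^ 2)⁻¹ * Real.exp (-(δ * g.dist a a'))) := by
    refine hasMajorant_mono (g := toB6 g Rr H) _ hV0 fun y y' => ?_
    have h0 : 0 ≤ 28 * (Fintype.card κ : ℝ) * (Fintype.card κ + 1) * M * α₁ * (g.len y ^ 2)⁻¹ * Real.exp (-(δ * g.dist y y')) := by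
      positivity
    have e : cV385 (Fintype.card κ) α₁ C₀ M * α₁ * (g.len y ^ 2)⁻¹ * Real.exp (-(δ * g.dist y y'))
        = cV0 (Fintype.card κ) α₁ C₀ * M₂ * (∑ i, ‖b i‖) * Real.exp (δ * d₀) * α₁ * (g.len y ^ 2)⁻¹ *
            Real.exp (-(δ * g.dist y y'))
          + 28 * (Fintype.card κ : ℝ) * (Fintype.card κ + 1) * M * α₁ * (g.len y ^ 2)⁻¹ * Real.exp (-(δ * g.dist y y')) := by
      rw [hM]; unfold cV385; ring
    rw [e]
    linarith
  have hsum : ∑ _k ∈ (Finset.univ : Finset (κ ⊕ κ)), 14 * ((Fintype.card κ : ℝ) + 1) * M₂ * (∑ i, ‖b i‖) * Real.exp (δ * d₀)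
      ≤ cV385 (Fintype.card κ) α₁ C₀ M := by
    rw [Finset.sum_const, Finset.card_univ, Fintype.card_sum, nsmul_eq_mul, Nat.cast_add]
    have h0 : 0 ≤ cV0 (Fintype.card κ) α₁ C₀ * M := mul_nonneg hcV0 hM0
    have e : cV385 (Fintype.card κ) α₁ C₀ M
        = cV0 (Fintype.card κ) α₁ C₀ * M
          + ((Fintype.card κ : ℝ) + Fintype.card κ) * (14 * ((Fintype.card κ : ℝ) + 1) * M₂ * (∑ i, ‖b i‖) *
            Real.exp (δ * d₀)) := by
      rw [hM]; unfold cV385; ring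
    rw [e]
    linarith
  exact thm34_G_entries13_opForm_of_comm_sum (R := Rr) (H := H) (fun q : (κ × S) × ι => blk q.1.2) d Finset.univ δ₀ δ α β ρ α'
    Λ Λρ B₀ (cV385 (Fintype.card κ) α₁ C₀ M) κ₁ κ₂ α₁
    (fun _ => 14 * ((Fintype.card κ : ℝ) + 1) * M₂ * (∑ i, ‖b i‖) * Real.exp (δ * d₀))
    (fun _ => (10 + 8 * Fintype.card κ + (16 * Fintype.card κ + 12) * C₀) * M)
    hB₀ hcV hκ₁ hκ₂ hα₁ hΛ hΛρ hρ hα hβ hδ₀ hr hα' hα'ρ0 hα'ρ2 (fun k _ => by positivity) hsum (fun k _ => hcK0) hdnn htri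
    hrefl hsym hlen h261 h261' hT1 hT2 hT1i hT2i hTρ hsmall385
    (V1 := fun k => conj b (V1Letter T U A k) + conj b (V1Letter₂ T U A k))
    (D := fun k => conj b (diffLetter (bT T) (bU U) ((g.eta : ℂ)⁻¹) k))
    hV₃ hV₃' h371 h376 h380 h380s hP₂def hΔG hGΔ hV0' (fun k _ => hV1 k)
    (fun k _ => hasMajorant_mono (g := toB6 g Rr H) _ (hComm k) fun y y' => le_of_eq (by rw [hM]; ring))
    hP₁ hP₂ hG (fun k _ => hDG k) (fun k _ => hGD k) hGDs

end Concrete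

end Literature.MathematicalPhysics.QuantumFieldTheory.Balaban1983to89.B9Ineq386V3Concrete
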